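import Summits.BirchSwinnertonDyer.BirchSwinnertonDyer.Theorems.TwoAdicConverseOrdLambdaHalfAtTwoThetaSupplyFineTorsionOfPub
import Literature.NumberTheory.EllipticCurves.Kato2004.LocalIwasawaCohomologyTorsionFiniteProofs
import Literature.NumberTheory.EllipticCurves.Kato2004.IwasawaH1ProjZeroKernelProofs
import Literature.NumberTheory.EllipticCurves.Kato2004.IwasawaH1LambdaTorsionFreeProofs
import HarnessLib

/-!
# Route `TwoAdicConverse` (rung S3), crux `OrdLambdaHalfAtTwo` (item stmt-BirchSwinnertonDyer-19556), line
# `kato_determinant_greenberg_two` (skeleton v4.12 → v4.13): the print-bundle conjuncts (12.2.3)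
# `Kato2004.localIwasawaH1_tateRep_moduleFinite` AND Kato 12.4 `Kato2004.thm12_4` are REDUNDANT inside stub 4‴ — `𝐇¹_{loc,Γ}(T₂W)` is
# finitely generated over `Λ` FROM the Shapiro/Poitou–Tate package, the KERNEL global (12.2.1) and the finiteness of its `2`-torsion; and
# Thm 12.4 entered only through the torsion-freeness of `𝐇¹_Γ(T₂W)`, `𝐇¹_Γ(T₂A)`, a KERNEL theorem (`IwasawaH1Data.isTorsionFree`, cell `bsd-potss`)

Cell `pub/bsd-2adic`, LEAD seat `cruxlead-stmt-BirchSwinnertonDyer-19556` (g10; `--supports stmt-BirchSwinnertonDyer-19556`).  Up to v4.12 the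
registered print stub `stub_katoFinePrintBundleAtTwo` of the line displays FOUR named Literature facts {F3-K, (12.2.3), Kato 12.4, PT-K}, fed into
conv-1's assembly `TwoAdicThetaSupply.thetaShapiroKatoGreenbergSupplyAtTwo_of_inputs_of_pub` (p715929), where (12.2.3) is consumed ONLY as the field
`finiteHl : Module.Finite Λ J.H` of `PinnedKatoCore` (`J = 𝐇¹_{loc,Γ}(T₂W|_{Γ_{ℚ₂}})`, the pinned local Iwasawa cohomology).  But the SAME assembly
holds, from the (PT) package `ShapiroLatticePoitouTateAtTwoTheta` (itself `_of_facts` Kato 12.4 + PT-K, conv-1 p702717): a lattice `L ≤ J.H` with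
`2·L ≤ range(loc_W ⊕ 𝐇¹(u_A)∘loc_A)` and an INJECTIVE `θ`-semilinear `δ : J.H ⧸ L ↪ X_Gr`, `θ` a ring automorphism of `Λ`; and `X_Gr` is finitely
generated (B2, kernel, an input `hcot` of the binder).  Hence:

* `J.H ⧸ L` is finitely generated (`Submodule.fg_of_fg_map_injective` along the semilinear `δ`, `θ` onto, `X_Gr` noetherian);
* `range(loc_W ⊕ …)` is finitely generated, being the image of `𝐇¹_Γ(T₂W) × 𝐇¹_Γ(T₂A)`, finitely generated by the KERNEL global (12.2.1)
  `Kato2004.IwasawaH1Data.module_finite_of_isCyclotomic` (cell `bsd-potss`, (14.14.1) chain + compact Nakayama, every `p`);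
* `L` is finitely generated: `2·L ≤ range` and `L ∩ J.H[2]` is FINITE — the new Literature theorem
  `Kato2004.LocalIwasawaH1Data.finite_setOf_natCast_smul_eq_zero_tateRep` (`#𝐇¹_{loc,Γ}(T_pW)[p] ≤ #W[p]`: cocycle-level
  `H¹_cont(G,T)[p] ↪ T/pT` + pigeonhole in the inverse system; every `p`, every place);
* so `J.H` is finitely generated (extension of `J.H ⧸ L` by `L`).

SECOND CUT (same file, §0).  In conv-1's derivation `TwoAdicShapiroLattice.shapiroLatticePoitouTateAtTwoTheta_of_facts h124 hPTK` (p702717) of the (PT)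
package from {Kato 12.4, PT-K}, the named fact `Kato2004.thm12_4` is consumed at ONE place (`coprod_loc_injective_of_thm12_4_of_locOver_injective`, p702252):
`Module.IsTorsionFree Λ 𝐇¹_Γ(T₂W)` and `… 𝐇¹_Γ(T₂A)` — which is the UNCONDITIONAL tree theorem `Kato2004.IwasawaH1Data.isTorsionFree` (cell `bsd-potss`,
`Kato2004/IwasawaH1LambdaTorsionFreeProofs.lean`, every `p`, every `ℤ_p`-extension with a topological generator; in the tree since 2026-08-27).  So (PT) follows
from PT-K ALONE (`shapiroLatticePoitouTateAtTwoTheta_of_PTK`).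

## What is proved
* §0 `coprod_loc_injective_of_locOver_injective_kernel` (= p702252 with `h124` replaced by `IwasawaH1Data.isTorsionFree`) and
  **`shapiroLatticePoitouTateAtTwoTheta_of_PTK` : PT-K → (PT)** (= p702717's derivation with `h124` gone).
* §1 `module_finite_of_sandwich_of_semilinear_injective` — the module-theoretic spine over `Λ = ℤ_p⟦X⟧`, any `p`: `R` f.g., `p·L ≤ R`,
  `{x | p x = 0}` finite, `H ⧸ L ↪_θ X` f.g. ⟹ `H` f.g.
* §2 `module_finite_localIwasawaH1_of_shapiroPT` — `Module.Finite Λ J.H` for the line's pinned local carrier from the (PT) data (any `θ`, any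
  finitely generated target), `κ` cyclotomic.
* §3 `thetaShapiroKatoGreenbergSupplyAtTwo_of_inputs_of_pub'` (= p715929's assembly with `finiteHl` DERIVED),
  `thetaShapiroKatoGreenbergSupplyAtTwo_of_print3_of_lambdaShapiro` : 4‴ ⟸ {PUB (item 19167), F3-K, Kato 12.4, PT-K} + (S) (three bundle facts), and
  **`thetaShapiroKatoGreenbergSupplyAtTwo_of_print2_of_lambdaShapiro` : 4‴ ⟸ {PUB (item 19167), F3-K, PT-K} + (S)** — TWO bundle facts instead of four;
  for the skeleton v4.13: `stub_katoFinePrintBundleAtTwo := F3-K ∧ PT-K` (both READING@2; no PRINT-tier fact left in the bundle).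

HONEST FRAMING.  THEOREMS ONLY; no definition, no named fact, no instance, no `sorry`.  §3 is CONDITIONAL on the named inputs (+ (S), a kernel theorem fed
by name); neither (12.2.3) nor Thm 12.4 is proved here (they stay declared debt for their other consumers — K4's Kato bundle, the ordinary-kernel-functional
chain of `cruxlead-19573-w3`, the rank-one clause); what is proved is that THIS line never needed them: modulo PT-K and B2 the finite generation of
`𝐇¹_loc(T₂W)` is a theorem, and the torsion-freeness of `𝐇¹_Γ` is bsd-potss's theorem.  The crux `OrdLambdaHalfAtTwo` is NOT proved here (O1/O2 research,
PUB print); BSD is not proved by any of this.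
PARTITION (D-0054): none — RANK axis S3 × X5@2 stratum (β); closes none (the lead re-registers the skeleton).
-/

set_option linter.dupNamespace false
set_option autoImplicit false

noncomputable section

open scoped NumberField
open Field IsDedekindDomain WeierstrassCurve CategoryTheory
open Literature.NumberTheory.GaloisRepresentations
open Literature.NumberTheory.EllipticCurves Literature.NumberTheory.EllipticCurves.Kato2004
open Literature.NumberTheory.EllipticCurves.Kato2004.EulerSystemValues

/-! ## §0 (PT) from PT-K alone: Kato 12.4 (2)'s torsion-freeness is the tree theorem `IwasawaH1Data.isTorsionFree` -/

namespace Summit.BirchSwinnertonDyer.BirchSwinnertonDyer.Theorems.TwoAdicShapiroLattice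

open NumberField
open Summit.BirchSwinnertonDyer.BirchSwinnertonDyer.Theorems.TwoAdicShapiroPT
open Literature.NumberTheory.EllipticCurves.Castella2018 (AcSelmer.bdpData)

/-- **Conjunct (4) `loc_injective` of the (PT) binder from ONE displayed input — NO named fact** (= p702252's
`coprod_loc_injective_of_thm12_4_of_locOver_injective` with `Kato2004.thm12_4` REPLACED by the kernel theorem `Kato2004.IwasawaH1Data.isTorsionFree`): in the habitat,
IF `loc_w̄ = IK.locOver J` is injective THEN `loc_W ⊕ 𝐇¹(u_v)∘loc_A` is injective.  Torsion-freeness of `𝐇¹_Γ(T_pW)`, `𝐇¹_Γ(T_pA)` is the tree's unconditional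
theorem (cell `bsd-potss`, `IwasawaH1LambdaTorsionFreeProofs`, every `p`, any `ℤ_p`-extension with a topological generator) — `κ` need not even be cyclotomic here.
[cite: Kato2004Asterisque, Thm 12.4 (2) (p. 221), §17.13 (17.13.2) (p. 279)] [cite: Greenberg2010, Prop. 3.1.1] [cite: GreenbergLNM1716, §4 p. 107] -/
theorem coprod_loc_injective_of_locOver_injective_kernel
    {K : Type} [Field K] [NumberField K] (hK : IsImaginaryQuadratic K)
    {p : ℕ} [Fact p.Prime] {κ : ZpExtension ℚ p}
    {h : Function.Surjective (κ.toContinuousMonoidHom.comp (absGaloisRestrict ℚ K))}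
    {v : HeightOneSpectrum (𝓞 ℚ)}
    {hD : ∀ g : absoluteGaloisGroup (v.adicCompletion ℚ), resGalOfEmb (closureEmb (K := ℚ) (v.adicCompletion ℚ)) g ∈ galRange (K := ℚ) K}
    {W A : WeierstrassCurve ℚ} [W.IsElliptic] [A.IsElliptic] [ContinuousSMul ℤ_[p] (W.tateModule p)]
    [ContinuousSMul ℤ_[p] (A.tateModule p)] [ContinuousSMul ℤ_[p] ((W.baseChange K).tateModule p)]
    (u : A.tateModule p ≃ₗ[ℤ_[p]] W.tateModule p) (hu : Continuous u) (hu' : Continuous u.symm)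
    (hu₁ : ∀ σ : absoluteGaloisGroup ℚ, σ ∈ galRange (K := ℚ) K → ∀ x : A.tateModule p, u (σ • x) = σ • u x)
    (hu₂ : ∀ σ : absoluteGaloisGroup ℚ, σ ∉ galRange (K := ℚ) K → ∀ x : A.tateModule p, u (σ • x) = -(σ • u x))
    {γ : absoluteGaloisGroup ℚ} {γK : absoluteGaloisGroup K} {γᵥ : absoluteGaloisGroup (v.adicCompletion ℚ)}
    (hγ : κ.IsTopGenerator γ) (hγK : (κ.restrict K h).IsTopGenerator γK)
    (hsurjv : Function.Surjective (κ.toContinuousMonoidHom.comp (resGalOfEmb (closureEmb (K := ℚ) (v.adicCompletion ℚ)))))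
    (hγᵥ : κ.IsTopGenerator (resGalOfEmb (closureEmb (K := ℚ) (v.adicCompletion ℚ)) γᵥ))
    (I_W : IwasawaH1Data W p κ γ) (I_A : IwasawaH1Data A p κ γ) (IK : IwasawaH1DataOver (W.baseChange K) p (κ.restrict K h) γK)
    (J : LocalIwasawaH1Data κ v ((tateRep W p).toLocal v) γᵥ) (J_A : LocalIwasawaH1Data κ v ((tateRep A p).toLocal v) γᵥ)
    (hloc : Function.Injective (IK.locOver J hD hsurjv hγK hγᵥ)) :
    Function.Injective
      ((I_W.loc J hsurjv hγ hγᵥ).coprod (J_A.map (localTwistHom v hD W A u hu hu₁) J ∘ₗ I_A.loc J_A hsurjv hγ hγᵥ)) := by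
  haveI : (galRange (K := ℚ) K).Normal := normal_galRange_of_finrank_eq_two K hK.1
  haveI : Module.IsTorsionFree (IwasawaAlgebra p) I_W.H := I_W.isTorsionFree hγ
  haveI : Module.IsTorsionFree (IwasawaAlgebra p) I_A.H := I_A.isTorsionFree hγ
  exact IK.coprod_loc_injective_of_locOver_injective u hu hu' hu₁ hu₂ I_W I_A J J_A (index_galRange_eq_two hK) hsurjv hγ hγK hγᵥ hloc

/-- **The (PT) binder from PT-K ALONE: `Kato2004.poitouTate_shapiroLattice_bdp_two → ShapiroLatticePoitouTateAtTwoTheta`** (= conv-1's p702717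
`shapiroLatticePoitouTateAtTwoTheta_of_facts` with the binder `h124 : Kato2004.thm12_4` REMOVED — its one use, the torsion-freeness of `𝐇¹_Γ(T₂W)` and `𝐇¹_Γ(T₂A)`,
is `coprod_loc_injective_of_locOver_injective_kernel`).  The split datum `hD` at `2`, `κ ∘ res_{K/ℚ}` onto, the twist equivalence `u` and its local untwisting,
a `K`-pin `IK`, `L := range locOver` with the two lattice clauses, conjuncts (1)/(2) of the Poitou–Tate reading, the latter upgraded to `loc_injective`.
[cite: Nekovar2006, 8.9.6.1–8.9.6.2 (p. 240)] [cite: Greenberg2010, Prop. 3.1.1] [cite: Kato2004Asterisque, Thm 12.4 (2) (p. 221), §17.13 (17.13.1)–(17.13.2) (p. 279)]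
[cite: GreenbergLNM1716, §4 p. 107] -/
theorem shapiroLatticePoitouTateAtTwoTheta_of_PTK (hPTK : Kato2004.poitouTate_shapiroLattice_bdp_two) :
    ShapiroLatticePoitouTateAtTwoTheta := by
  intro W _ _ K _ _ hK hH A _ _ C hA w hw κ γ hκ hγ κK γK hκK hγK v hv γᵥ hsurj hγᵥ I_W I_A J J_A DGr Dfi
  haveI : ContinuousSMul ℤ_[2] ((W.baseChange K).tateModule 2) := TateModule.continuousSMul_padicInt
  haveI : (galRange (K := ℚ) K).Normal := normal_galRange_of_finrank_eq_two K hK.1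
  have hsplit : ((Ideal.span {(2 : ℤ)}).primesOver (𝓞 K)).ncard = 2 := by
    have := hH 2 Nat.prime_two (dvd_refl 2)
    simpa using this
  have hD : ∀ g : absoluteGaloisGroup (v.adicCompletion ℚ),
      resGalOfEmb (closureEmb (K := ℚ) (v.adicCompletion ℚ)) g ∈ galRange (K := ℚ) K :=
    resGalOfEmb_mem_galRange_of_split_two hK.1 hsplit (primesEquiv_eq_two_of_mem hv)
  have h := surjective_comp_absGaloisRestrict_two K hK κ hκ
  obtain ⟨u, hu, hu', hu₁, hu₂⟩ := exists_twist_equiv K 2 hK.1 W A C hA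
  obtain ⟨γK', hγK'⟩ := ZpExtension.exists_isTopGenerator (κ.restrict K h)
  obtain ⟨IK⟩ := nonempty_iwasawaH1DataOver (V := W.baseChange K) (p := 2) (κ := κ.restrict K h) hγK'
  have hbij : Function.Bijective (localTwistHom v hD W A u hu hu₁).hom := by
    have hcoe : ⇑(localTwistHom v hD W A u hu hu₁).hom = ⇑u := funext fun x ↦ localTwistHom_hom_apply v hD W A u hu hu₁ x
    rw [hcoe]
    exact u.bijective
  obtain ⟨⟨θ, θ_C, δ, π, hδ, hπ, hex⟩, hinj⟩ :=
    hPTK W K hK w hw κ γ hκ hγ h γK' hγK' κK γK hκK hγK v hv hD γᵥ hsurj hγᵥ IK J DGr Dfi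
  exact ⟨localTwistHom v hD W A u hu hu₁, hbij, LinearMap.range (IK.locOver J hD hsurj hγK' hγᵥ),
    IK.range_coprod_loc_le_range_locOver u hu hu₁ I_A J J_A I_W hsurj hγ hγK' hγᵥ,
    fun y hy ↦ IK.two_smul_mem_range_coprod_loc_of_mem_range_locOver u hu hu' hu₁ hu₂ I_A J J_A I_W hsurj hγ hγK' hγᵥ hy,
    ⟨θ, θ_C, δ, π, hδ, hπ, hex⟩,
    fun hfin htors ↦ coprod_loc_injective_of_locOver_injective_kernel hK u hu hu' hu₁ hu₂ hγ hγK' hsurj hγᵥ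
      I_W I_A IK J J_A (hinj hfin htors)⟩

end Summit.BirchSwinnertonDyer.BirchSwinnertonDyer.Theorems.TwoAdicShapiroLattice

namespace Summit.BirchSwinnertonDyer.BirchSwinnertonDyer.Theorems.TwoAdicThetaSupply

/-! ## §1 The module-theoretic spine over `Λ = ℤ_p⟦X⟧` -/

section Spine

variable {p : ℕ} [Fact p.Prime]

/-- **Finite generation from a sandwich and a semilinear embedding of the quotient.**  Over `Λ = ℤ_p⟦X⟧` (noetherian): if `R ≤ H` is finitely
generated, `L ≤ H` satisfies `p·L ≤ R`, the `p`-torsion SET of `H` is finite, and `H ⧸ L` embeds `θ`-semilinearly (`θ` a ring automorphism of `Λ`)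
into a finitely generated `Λ`-module `X`, then `H` is finitely generated.  (`L` is f.g.: `p·(·)` maps `L` into the noetherian `R` with kernel inside the
finite `p`-torsion; `H ⧸ L` is f.g. by `Submodule.fg_of_fg_map_injective` for the semilinear `δ`; extensions of f.g. by f.g. are f.g.)
[cite: BourbakiAC5to7, Ch. VII §4.4 (shape only: noetherian module bookkeeping)] -/
theorem module_finite_of_sandwich_of_semilinear_injective
    {H : Type*} [AddCommGroup H] [Module (IwasawaAlgebra p) H]
    (R L : Submodule (IwasawaAlgebra p) H) (hR : R.FG)
    (hL : ∀ y ∈ L, (p : IwasawaAlgebra p) • y ∈ R)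
    (htors : {x : H | (p : IwasawaAlgebra p) • x = 0}.Finite)
    (θ : IwasawaAlgebra p ≃+* IwasawaAlgebra p)
    {X : Type*} [AddCommGroup X] [Module (IwasawaAlgebra p) X] [Module.Finite (IwasawaAlgebra p) X]
    (δ : (H ⧸ L) →ₛₗ[(θ : IwasawaAlgebra p →+* IwasawaAlgebra p)] X) (hδ : Function.Injective δ) :
    Module.Finite (IwasawaAlgebra p) H := by
  classical
  -- (a) `L` is finitely generated
  have hLfg : L.FG := by
    let f : H →ₗ[IwasawaAlgebra p] H := LinearMap.lsmul (IwasawaAlgebra p) H (p : IwasawaAlgebra p)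
    refine Submodule.fg_of_fg_map_of_fg_inf_ker f ?_ ?_
    · have hle : L.map f ≤ R := Submodule.map_le_iff_le_comap.mpr fun y hy => by
        simpa only [Submodule.mem_comap, f, LinearMap.lsmul_apply] using hL y hy
      haveI : IsNoetherian (IwasawaAlgebra p) R := isNoetherian_of_fg_of_noetherian _ hR
      haveI : IsNoetherian (IwasawaAlgebra p) (L.map f) := isNoetherian_of_le hle
      exact Module.Finite.iff_fg.mp inferInstance
    · have hsub : ((L ⊓ LinearMap.ker f : Submodule (IwasawaAlgebra p) H) : Set H) ⊆
          {x : H | (p : IwasawaAlgebra p) • x = 0} := fun x hx => by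
        have hx2 : x ∈ LinearMap.ker f := (Submodule.mem_inf.mp hx).2
        simpa only [Set.mem_setOf_eq, LinearMap.mem_ker, f, LinearMap.lsmul_apply] using hx2
      haveI : Finite (L ⊓ LinearMap.ker f : Submodule (IwasawaAlgebra p) H) := (htors.subset hsub).to_subtype
      exact Module.Finite.iff_fg.mp inferInstance
  -- (b) `H ⧸ L` is finitely generated
  haveI : RingHomSurjective (θ : IwasawaAlgebra p →+* IwasawaAlgebra p) := ⟨θ.surjective⟩
  have hQfg : (⊤ : Submodule (IwasawaAlgebra p) (H ⧸ L)).FG :=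
    Submodule.fg_of_fg_map_injective δ hδ (IsNoetherian.noetherian _)
  -- (c) `H` is finitely generated
  have htop : (⊤ : Submodule (IwasawaAlgebra p) H).FG := by
    refine Submodule.fg_of_fg_map_of_fg_inf_ker L.mkQ ?_ ?_
    · rwa [Submodule.map_top, Submodule.range_mkQ]
    · rwa [top_inf_eq, Submodule.ker_mkQ]
  exact Module.finite_def.mpr htop

end Spine

/-! ## §2 `𝐇¹_{loc,Γ}(T₂W)` is finitely generated from the (PT) data -/

section LocalFinite

variable {W : WeierstrassCurve ℚ} [W.IsElliptic] [ContinuousSMul ℤ_[2] (W.tateModule 2)]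
  {A : WeierstrassCurve ℚ} [A.IsElliptic] [ContinuousSMul ℤ_[2] (A.tateModule 2)]
  {κ : ZpExtension ℚ 2} {γ : absoluteGaloisGroup ℚ}

/-- **`Module.Finite Λ (𝐇¹_{loc,Γ}(T₂W))` from the Shapiro/Poitou–Tate data — no (12.2.3).**  For the cyclotomic `κ`, a generator `γ`, the pins
`I_W`, `I_A`, `J`, `J_A`, the untwisting `u_A`, ANY lattice `L ≤ J.H` with `2·L ≤ range(loc_W ⊕ 𝐇¹(u_A)∘loc_A)`, ANY ring automorphism `θ` of `Λ`
and ANY injective `θ`-semilinear `δ : J.H ⧸ L → X` into a finitely generated `Λ`-module `X` (the line: `X = X_Gr`, f.g. by B2): `J.H` is finitely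
generated — §1 with `R := range(loc_W ⊕ …)` (f.g.: `𝐇¹_Γ(T₂W)`, `𝐇¹_Γ(T₂A)` are f.g. by the KERNEL (12.2.1)
`Kato2004.IwasawaH1Data.module_finite_of_isCyclotomic`) and the finite `2`-torsion of `J.H`
(`Kato2004.LocalIwasawaH1Data.finite_setOf_natCast_smul_eq_zero_tateRep`).
[cite: Kato2004Asterisque, §12.2 (12.2.1), (12.2.3) (p. 220), §17.13 (p. 279)] [cite: GreenbergLNM1716, §1 p. 60 (the two Λ-structures)] -/
theorem module_finite_localIwasawaH1_of_shapiroPT (hκ : κ.IsCyclotomic) (hγ : κ.IsTopGenerator γ)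
    (I_W : IwasawaH1Data W 2 κ γ) (I_A : IwasawaH1Data A 2 κ γ)
    {v : HeightOneSpectrum (𝓞 ℚ)} {γᵥ : absoluteGaloisGroup (v.adicCompletion ℚ)}
    (J : LocalIwasawaH1Data κ v ((tateRep W 2).toLocal v) γᵥ)
    (J_A : LocalIwasawaH1Data κ v ((tateRep A 2).toLocal v) γᵥ)
    (uA : ((tateRep A 2).toLocal v).toTopRep ⟶ ((tateRep W 2).toLocal v).toTopRep)
    (hsurj : Function.Surjective
      (κ.toContinuousMonoidHom.comp (resGalOfEmb (closureEmb (K := ℚ) (v.adicCompletion ℚ)))))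
    (hγᵥ : κ.IsTopGenerator (resGalOfEmb (closureEmb (K := ℚ) (v.adicCompletion ℚ)) γᵥ))
    (L : Submodule (IwasawaAlgebra 2) J.H)
    (h2L : ∀ y ∈ L, (2 : IwasawaAlgebra 2) • y ∈
      LinearMap.range ((I_W.loc J hsurj hγ hγᵥ).coprod (J_A.map uA J ∘ₗ I_A.loc J_A hsurj hγ hγᵥ)))
    (θ : IwasawaAlgebra 2 ≃+* IwasawaAlgebra 2)
    {X : Type*} [AddCommGroup X] [Module (IwasawaAlgebra 2) X] [Module.Finite (IwasawaAlgebra 2) X]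
    (δ : (J.H ⧸ L) →ₛₗ[(θ : IwasawaAlgebra 2 →+* IwasawaAlgebra 2)] X) (hδ : Function.Injective δ) :
    Module.Finite (IwasawaAlgebra 2) J.H := by
  haveI := IwasawaH1Data.module_finite_of_isCyclotomic hκ hγ I_W
  haveI := IwasawaH1Data.module_finite_of_isCyclotomic hκ hγ I_A
  exact module_finite_of_sandwich_of_semilinear_injective (p := 2)
    (LinearMap.range ((I_W.loc J hsurj hγ hγᵥ).coprod (J_A.map uA J ∘ₗ I_A.loc J_A hsurj hγ hγᵥ))) L
    (Submodule.fg_range _) (fun y hy => h2L y hy)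
    (Kato2004.LocalIwasawaH1Data.finite_setOf_natCast_smul_eq_zero_tateRep W 2 J) θ δ hδ

end LocalFinite

/-! ## §3 Stub 4‴ from {PUB, F3-K, Kato 12.4, PT-K} + (S) — without (12.2.3) -/

open scoped MatrixGroups ModularForm
open CongruenceSubgroup NumberField Literature.NumberTheory.EllipticCurves.ModularForms
open Literature.NumberTheory.EllipticCurves.Rank1Residual
open Summit.BirchSwinnertonDyer.BirchSwinnertonDyer.Theorems.TwoAdicKatoDeterminant
open Summit.BirchSwinnertonDyer.BirchSwinnertonDyer.Theorems.TwoAdicShapiroPT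
open Summit.BirchSwinnertonDyer.BirchSwinnertonDyer.Theorems.TwoAdicShapiroLattice
open Summit.BirchSwinnertonDyer.BirchSwinnertonDyer.Theorems.TwoAdicColemanTransport
open Summit.BirchSwinnertonDyer.Rank1Residual.X1.MuLambda (lam)
open Summit.BirchSwinnertonDyer.Rank1Residual.X11b (AcSelmer.bdpData AcSelmer.strictDatum)

/-- **STUB 4‴ `ThetaShapiroKatoGreenbergSupplyAtTwo` ⟸ FIVE NAMED INPUTS, no (12.2.3)** (= p715929's
`thetaShapiroKatoGreenbergSupplyAtTwo_of_inputs_of_pub` with the binder `hHl : Kato2004.localIwasawaH1_tateRep_moduleFinite` REMOVED: the field `finiteHl`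
is DERIVED by `module_finite_localIwasawaH1_of_shapiroPT` from the (PT) output and `hcot`).  Inputs: [PUB] `OrdConversePublishedInputsAtTwo` (item 19167) ·
[F3-K] `Kato2004.exists_zetaClass_colemanMinus_recLaw_index_two` · [ORD] `Kato2004.tateModuleFilAt_inertia_ordinary` · [(S)] `LambdaShapiroFineAtTwo` · [(PT)]
`ShapiroLatticePoitouTateAtTwoTheta`.  The assembly is p715929's verbatim except for the line `finiteHl`.  CONDITIONAL on the five inputs; the crux is NOT
proved here. [cite: Kato2004Asterisque, Thm 12.5, Thm 17.4 (1), §17.13, Thm 16.6, Prop 17.11] [cite: GreenbergLNM1716, §2 (pp. 62–64)]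
[cite: GreenbergVatsal2000, §2] -/
theorem thetaShapiroKatoGreenbergSupplyAtTwo_of_inputs_of_pub'
    (hPub : Literature.Uncategorized.OrdConversePublishedInputsAtTwo)
    (hF3K : Kato2004.exists_zetaClass_colemanMinus_recLaw_index_two)
    (hOrd : Kato2004.tateModuleFilAt_inertia_ordinary)
    (hS : LambdaShapiroFineAtTwo) (hPT : ShapiroLatticePoitouTateAtTwoTheta) :
    ThetaShapiroKatoGreenbergSupplyAtTwo := by
  intro W _ _ hCM hGO hβ κ γ hκ hγ hγ' hord _ f hf D L₀ hL₀ K _ _ hK A _ _ C hA hordA _ g hg DA L₀' hL₀' w hw κK γK hκK hγK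
    DGr Dfi hcot _ _
  obtain ⟨-, hKato, -⟩ := hPub
  -- the place `2`, a local lift of the generator, the pins
  obtain ⟨v, hv⟩ : ∃ v : HeightOneSpectrum (𝓞 ℚ), ((2 : ℕ) : 𝓞 ℚ) ∈ v.asIdeal := by
    have hne : Ideal.span {((2 : ℕ) : 𝓞 ℚ)} ≠ ⊤ := by
      rw [Ne, Ideal.span_singleton_eq_top]
      intro h
      have h2 : IsUnit ((2 : ℕ) : ℤ) := by
        have := h.map (Rat.IsIntegralClosure.intEquiv (𝓞 ℚ))
        rwa [map_natCast] at this
      exact absurd (Int.isUnit_iff.mp h2) (by norm_num)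
    obtain ⟨M, hM, hle⟩ := Ideal.exists_le_maximal _ hne
    have hM0 : M ≠ ⊥ := by
      intro h0
      rw [h0, le_bot_iff, Ideal.span_singleton_eq_bot] at hle
      exact two_ne_zero (by exact_mod_cast hle)
    exact ⟨⟨M, hM.isPrime, hM0⟩, hle (Ideal.mem_span_singleton_self _)⟩
  obtain ⟨γᵥ, hγᵥ⟩ := hκ.exists_isTopGenerator_resGalOfEmb_adicCompletion v hv
  have hsurj : Function.Surjective
      (κ.toContinuousMonoidHom.comp (resGalOfEmb (closureEmb (K := ℚ) (v.adicCompletion ℚ)))) := fun t ↦ by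
    obtain ⟨g₀, -, hg₀⟩ := hκ.exists_mem_absInertia_apply_resGalOfEmb_adicCompletion_eq v hv t
    exact ⟨g₀, hg₀⟩
  obtain ⟨I_W⟩ := Kato2004.nonempty_iwasawaH1Data_holds W 2 κ γ hκ hγ
  obtain ⟨I_A⟩ := Kato2004.nonempty_iwasawaH1Data_holds A 2 κ γ hκ hγ
  obtain ⟨J⟩ := nonempty_localIwasawaH1Data κ v ((tateRep W 2).toLocal v) γᵥ
  obtain ⟨J'⟩ := nonempty_localIwasawaH1Data κ v (tateLocalOrdinaryRep W 2 v) γᵥ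
  obtain ⟨J_A⟩ := nonempty_localIwasawaH1Data κ v ((tateRep A 2).toLocal v) γᵥ
  have hH2 : SatisfiesHeegnerHypothesis 2 K := hK.2.of_dvd (dvd_mul_right 2 _)
  -- (PT): the local untwisting, the Shapiro lattice, the re-keyed Poitou–Tate triple, loc-injectivity
  obtain ⟨uA, hbij, L, hle, h2L, ⟨θ, θ_C, δ, π, hδ, hπ, hex⟩, hinj⟩ :=
    hPT W K hK.1 hH2 A C hA w hw κ γ hκ hγ κK γK hκK hγK v hv γᵥ hsurj hγᵥ I_W I_A J J_A DGr Dfi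
  -- (12.2.3) REPLACED: `𝐇¹_loc(T₂W)` is finitely generated from (PT) + B2 + the kernel global (12.2.1) + finite `2`-torsion
  haveI : Module.Finite (IwasawaAlgebra 2) DGr.X := hcot.1
  have hHl : Module.Finite (IwasawaAlgebra 2) J.H :=
    module_finite_localIwasawaH1_of_shapiroPT hκ hγ I_W I_A J J_A uA hsurj hγᵥ L h2L θ δ hδ
  -- Kato per curve, read on W's carrier
  obtain ⟨col, zW, zA, uW, uA', nW, nA, hker, hcoker, hrecW, hrecA, htW, htA, hidxW, hidxA⟩ :=
    exists_colemanMinus_recLaws hF3K hOrd f hf hord g hg hordA κ γ hκ hγ hγ' L₀ hL₀ L₀' hL₀' v hv γᵥ hsurj hγᵥ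
      I_W I_A J J' J_A uA hbij
  -- torsion / finiteness of the cyclotomic duals (Kato 17.4 = PUB), fine duals over `ℚ_∞` BY conv-1's §1 (no X₀ fact)
  have hL₀0 : L₀ ≠ 0 := by
    rintro rfl; exact padicLFunction_unitRoot_ne_zero hord hf (by rw [← hL₀, map_zero])
  have hL₀'0 : L₀' ≠ 0 := by
    rintro rfl; exact padicLFunction_unitRoot_ne_zero hordA hg (by rw [← hL₀', map_zero])
  have hL₀1 : iwasawaToPowerSeries 2 L₀ = PowerSeries.C ((1 : ℚ) : ℚ_[2]) * padicLFunction f (unitRoot W 2 : ℚ_[2]) := by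
    rw [hL₀, Rat.cast_one, map_one, one_mul]
  have hL₀'1 : iwasawaToPowerSeries 2 L₀' = PowerSeries.C ((1 : ℚ) : ℚ_[2]) * padicLFunction g (unitRoot A 2 : ℚ_[2]) := by
    rw [hL₀', Rat.cast_one, map_one, one_mul]
  obtain ⟨hDt, -⟩ := Summit.BirchSwinnertonDyer.BirchSwinnertonDyer.Theorems.GVISeed.isTorsion_and_lambda_le_lam_of_kato W
    (hKato W f) hκ hγ hγ' hord hf D one_ne_zero hL₀1 hL₀0
  obtain ⟨hDAt, -⟩ := Summit.BirchSwinnertonDyer.BirchSwinnertonDyer.Theorems.GVISeed.isTorsion_and_lambda_le_lam_of_kato A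
    (hKato A g) hκ hγ hγ' hordA hg DA one_ne_zero hL₀'1 hL₀'0
  have hDfin : Module.Finite (IwasawaAlgebra 2) D.X := D.module_finite_holds hγ
  have hDAfin : Module.Finite (IwasawaAlgebra 2) DA.X := DA.module_finite_holds hγ
  obtain ⟨Y_W⟩ := W.nonempty_fineSelmerDualData κ hγ
  obtain ⟨Y_A⟩ := A.nonempty_fineSelmerDualData κ hγ
  have hYW := fineSelmerDual_finite_and_isTorsion_of_selmerDual_isTorsion W κ hγ D hDt Y_W
  have hYA := fineSelmerDual_finite_and_isTorsion_of_selmerDual_isTorsion A κ hγ DA hDAt Y_A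
  -- (S)
  obtain ⟨-, hlamS⟩ := hS W K hK.1 hH2 A C hA κ γ hκ hγ κK γK hκK hγK Y_W Y_A Dfi hYW.1 hYW.2 hYA.1 hYA.2
  have hiW := hidxW D Y_W hDfin hDt
  have hiA := hidxA DA Y_A hDAfin hDAt
  have hbW := PinnedKatoGreenbergDatum.lambdaInvariant_quotient_span_singleton_eq_lam hL₀0
  have hbA := PinnedKatoGreenbergDatum.lambdaInvariant_quotient_span_singleton_eq_lam hL₀'0
  refine ⟨v, γᵥ, hsurj, hγᵥ, I_W, I_A, J, J', J_A, uA, ⟨{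
    two_mem := hv
    uA_bijective := hbij
    colMinus := col
    colMinus_ker := hker
    colMinus_coker := hcoker
    zW := zW
    zA := zA
    nW := nW
    nA := nA
    unitW := uW
    unitA := uA'
    recW := hrecW
    recA := hrecA
    finiteHl := hHl
    loc_injective := hinj hcot.1 hcot.2
    isTorsion_quot := PinnedKatoCore.isTorsion_quot_of_poitouTate_semilinear zW zA htW htA L h2L θ δ hδ hcot.2
    L := L
    range_le := hle
    two_smul_mem := h2L
    θ := θ
    θ_C := θ_C
    δ := δ
    δ_injective := hδ
    π := π
    π_surjective := hπ
    exact_δ_π := hex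
    katoIndex := ?_ }⟩⟩
  change lambdaInvariant 2 _ + lambdaInvariant 2 _ + (lambdaInvariant 2 D.X + lambdaInvariant 2 DA.X) = _
  omega

/-- **STUB 4‴ FROM FOUR PRINTED NAMED FACTS + (S) — (12.2.3) DROPPED**: `ThetaShapiroKatoGreenbergSupplyAtTwo` from [PUB]
`OrdConversePublishedInputsAtTwo` (item 19167), [F3-K] `Kato2004.exists_zetaClass_colemanMinus_recLaw_index_two`, [Kato 12.4 (2)] `Kato2004.thm12_4`, [PT-K]
`Kato2004.poitouTate_shapiroLattice_bdp_two`, and the λ-Shapiro statement (S) `LambdaShapiroFineAtTwo` — a KERNEL THEOREM since p709423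
(`TwoAdicShapiroPT.lambdaShapiroFineAtTwo_holds`; kept as a binder here only so that this file does not import that one: feed it by name).  ORD
(`Kato2004.tateModuleFilAt_inertia_ordinary_holds`, audit-2 p701851), (PT) (`shapiroLatticePoitouTateAtTwoTheta_of_facts`, p702717), X₀-torsion (conv-1 GEN 33) AND
NOW (12.2.3) for `T₂W` (§2) are kernel.  For the skeleton v4.13: `stub_katoFinePrintBundleAtTwo := F3-K ∧ Kato 12.4 ∧ PT-K` and
`thetaShapiroKatoGreenbergSupplyAtTwo := thetaShapiroKatoGreenbergSupplyAtTwo_of_print3_of_lambdaShapiro stub_pub b.1 b.2.1 b.2.2 lambdaShapiroFineAtTwo_holds`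
— 4‴ ⟸ PUB + THREE bundle facts.  CONDITIONAL on the four facts (+ (S)); the crux is NOT proved here; BSD is not proved by any of this.
[cite: Kato2004Asterisque, Thm 12.4, 12.5, 16.6, 17.4 (1), Prop 17.11, §17.13] [cite: Nekovar2006, 8.9.6.1–8.9.6.2 (p. 240)] [cite: GreenbergLNM1716, §2, §4 p. 107] -/
theorem thetaShapiroKatoGreenbergSupplyAtTwo_of_print3_of_lambdaShapiro
    (hPub : Literature.Uncategorized.OrdConversePublishedInputsAtTwo)
    (hF3K : Kato2004.exists_zetaClass_colemanMinus_recLaw_index_two)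
    (h124 : Kato2004.thm12_4)
    (hPTK : Kato2004.poitouTate_shapiroLattice_bdp_two)
    (hS : LambdaShapiroFineAtTwo) :
    ThetaShapiroKatoGreenbergSupplyAtTwo :=
  thetaShapiroKatoGreenbergSupplyAtTwo_of_inputs_of_pub' hPub hF3K Kato2004.tateModuleFilAt_inertia_ordinary_holds hS
    (shapiroLatticePoitouTateAtTwoTheta_of_facts h124 hPTK)

/-- **STUB 4‴ FROM THREE PRINTED NAMED FACTS + (S) — (12.2.3) AND Kato 12.4 DROPPED**: `ThetaShapiroKatoGreenbergSupplyAtTwo` from [PUB]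
`OrdConversePublishedInputsAtTwo` (item 19167), [F3-K] `Kato2004.exists_zetaClass_colemanMinus_recLaw_index_two`, [PT-K] `Kato2004.poitouTate_shapiroLattice_bdp_two`, and the
λ-Shapiro statement (S) `LambdaShapiroFineAtTwo` (kernel theorem `TwoAdicShapiroPT.lambdaShapiroFineAtTwo_holds`, fed by name).  Kernel inside: ORD
(`Kato2004.tateModuleFilAt_inertia_ordinary_holds`), (PT) from PT-K alone (§0 `shapiroLatticePoitouTateAtTwoTheta_of_PTK`: Thm 12.4 (2)'s torsion-freeness =
`IwasawaH1Data.isTorsionFree`), X₀-torsion (conv-1 GEN 33), (12.2.3)∣_{T₂W} (§2).  For the skeleton v4.13: `stub_katoFinePrintBundleAtTwo := F3-K ∧ PT-K` and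
`thetaShapiroKatoGreenbergSupplyAtTwo := thetaShapiroKatoGreenbergSupplyAtTwo_of_print2_of_lambdaShapiro stub_pub b.1 b.2 lambdaShapiroFineAtTwo_holds` — 4‴ ⟸ PUB + TWO
bundle facts (both READING@2).  CONDITIONAL on the three facts (+ (S)); the crux is NOT proved here; BSD is not proved by any of this.
[cite: Kato2004Asterisque, Thm 12.4, 12.5, 16.6, 17.4 (1), Prop 17.11, §17.13] [cite: Nekovar2006, 8.9.6.1–8.9.6.2 (p. 240)] [cite: GreenbergLNM1716, §2, §4 p. 107] -/
theorem thetaShapiroKatoGreenbergSupplyAtTwo_of_print2_of_lambdaShapiro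
    (hPub : Literature.Uncategorized.OrdConversePublishedInputsAtTwo)
    (hF3K : Kato2004.exists_zetaClass_colemanMinus_recLaw_index_two)
    (hPTK : Kato2004.poitouTate_shapiroLattice_bdp_two)
    (hS : LambdaShapiroFineAtTwo) :
    ThetaShapiroKatoGreenbergSupplyAtTwo :=
  thetaShapiroKatoGreenbergSupplyAtTwo_of_inputs_of_pub' hPub hF3K Kato2004.tateModuleFilAt_inertia_ordinary_holds hS
    (Summit.BirchSwinnertonDyer.BirchSwinnertonDyer.Theorems.TwoAdicShapiroLattice.shapiroLatticePoitouTateAtTwoTheta_of_PTK hPTK)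

end Summit.BirchSwinnertonDyer.BirchSwinnertonDyer.Theorems.TwoAdicThetaSupply

end
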